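import Summits.Langlands.Langlands.Theorems.SoloInformedRepairR3plus

/-!
# R3⁺ is `𝓡`-independent exactly like the summit: the `∃ 𝓡` form of `LanglandsR3plus`

Summit `Langlands` (`Summits/Langlands/Langlands/Statement`); companion to
`Theorems/SoloInformedRepairR3plus` (the re-scoped summit shape `LanglandsR3plus`: local–global
compatibility away from `ℓ`, de Rham + labelled Hodge–Tate weights above `ℓ`) and the R3⁺ analogue of
`Theorems/SoloInformedRecIndependence` (the summit's hygiene row "`∀ 𝓡 ⇝ ∃ 𝓡`":
`langlands_iff_exists`, `globalLanglandsCorrespondenceGLn_one_iff`; that module is not imported here —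
its closure was unbuilt on the farm when this file was written — so the one lemma needed from it, the
`𝓡`-independence of `LocalGlobalCompatibleAt` given agreement of `rec_v` on the local components, is
re-derived inline inside `correspondsR3plus_iff`, and its hypothesis (U_occ)
`RecAgreeOnCuspidalComponents K` is spelled out).

The outer quantifier `∀ 𝓡 : ReciprocityData F` of the summit — kept verbatim in `LanglandsR3plus` — is
load-bearing only through `rec_v` on the local components of L-algebraic cuspidal `π`; the pinned
`p`-adic Hodge datum `𝓡.pst` does not depend on `𝓡` at all (it is `fontainePstAdicCompletion v ℓ hv` by
definition), and the added Hodge–Tate clause of R3⁺ reads only `𝓡.pst`.  Hence: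
`hodgeTateCompatibleAt_iff` (`Iff.rfl`), `correspondsR3plus_iff`, `automorphicToGaloisR3plus_iff`,
`galoisToAutomorphicR3plus_iff`, `globalLanglandsCorrespondenceGLnR3plus_iff` (agreement of the two
data on local components of L-algebraic cuspidal `π` of `GL_n(𝔸_K)` suffices), and
`langlandsR3plus_iff_exists`: under (U_occ) at every number field,
`LanglandsR3plus ↔ ∀ F, ∃ 𝓡, ∀ n ≥ 1, ∀ hcpt, GlobalLanglandsCorrespondenceGLnR3plus n F 𝓡 hcpt`;
`exists_of_langlandsR3plus` is the unconditional half.  (For `n = 1` the agreement hypothesis is a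
theorem, `recGL_one_eq` of `Theorems/SoloInformedRecIndependence`: `rec₁` is local class field theory
against the pinned Artin map.)  Pure logic; no new mathematics, no definitions.
Soloist file (`solo-Langlands-informed`, s51).
-/

noncomputable section

open scoped MatrixGroups Matrix Classical NumberField
open NumberField IsDedekindDomain Filter
open Literature.NumberTheory.Automorphic Literature.NumberTheory.GaloisRepresentations

namespace Summit.Langlands.Langlands.Theorems

namespace R3plus

open Summit.Langlands

variable {n : ℕ} {K : Type} [Field K] [NumberField K] {hcpt : isCompact_glFiniteIntegralLevel n K}
  {ℓ : ℕ} [Fact ℓ.Prime]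

/-- The Hodge–Tate clause does not depend on `𝓡`: it reads only the pinned datum `𝓡.pst ℓ v hv`,
which is `fontainePstAdicCompletion v ℓ hv` for every `𝓡`. [folklore] -/
theorem hodgeTateCompatibleAt_iff (𝓡 𝓡' : ReciprocityData K) (ι : PadicAlgCl ℓ ≃+* ℂ)
    (π : AutomorphicRepData (AutomorphyDatum.gl n K hcpt)) (ρ : FramedGaloisRep K (PadicAlgCl ℓ) n)
    (v : HeightOneSpectrum (𝓞 K)) (hv : ((ℓ : ℕ) : 𝓞 K) ∈ v.asIdeal) :
    HodgeTateCompatibleAt 𝓡 ι π ρ v hv ↔ HodgeTateCompatibleAt 𝓡' ι π ρ v hv := Iff.rfl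

/-- `CorrespondsR3plus` depends on `𝓡` only through `rec_v` on the local components of `π`: the
Satake clause and the Hodge–Tate clause do not mention `𝓡.llc`, and `LocalGlobalCompatibleAt 𝓡 ι π ρ v`
uses `𝓡` only in `(𝓡.llc v).recGL n [π_v]` and in the `𝓡`-independent `𝓡.pst`. [folklore] -/
theorem correspondsR3plus_iff {𝓡 𝓡' : ReciprocityData K} {ι : PadicAlgCl ℓ ≃+* ℂ}
    {π : AutomorphicRepData (AutomorphyDatum.gl n K hcpt)} {ρ : FramedGaloisRep K (PadicAlgCl ℓ) n}
    (hπ : ∀ (v : HeightOneSpectrum (𝓞 K)) (πv : SmoothIrrep (GL (Fin n) (v.adicCompletion K))),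
      π.HasLocalComponentAt v πv.ρ →
      (𝓡.llc v).recGL n (IrrClass.mk πv) = (𝓡'.llc v).recGL n (IrrClass.mk πv)) :
    CorrespondsR3plus 𝓡 ι π ρ ↔ CorrespondsR3plus 𝓡' ι π ρ := by
  have hLGC : ∀ v : HeightOneSpectrum (𝓞 K),
      LocalGlobalCompatibleAt 𝓡 ι π ρ v ↔ LocalGlobalCompatibleAt 𝓡' ι π ρ v := by
    intro v
    constructor
    · rintro ⟨πv, r, rℂ, hloc, h₁, h₂, h₃, h₄⟩
      exact ⟨πv, r, rℂ, hloc, h₁, h₂, h₃, hπ v πv hloc ▸ h₄⟩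
    · rintro ⟨πv, r, rℂ, hloc, h₁, h₂, h₃, h₄⟩
      exact ⟨πv, r, rℂ, hloc, h₁, h₂, h₃, (hπ v πv hloc).symm ▸ h₄⟩
  exact and_congr Iff.rfl
    (and_congr (forall_congr' fun v ↦ forall_congr' fun _ ↦ hLGC v) Iff.rfl)

/-- Direction (A), R3⁺ form, is `𝓡`-independent given agreement on the local components of
L-algebraic cuspidal `π`. [folklore] -/
theorem automorphicToGaloisR3plus_iff {𝓡 𝓡' : ReciprocityData K}
    (hcpt : isCompact_glFiniteIntegralLevel n K)
    (h : ∀ π : CuspidalAutomorphicRepData n K hcpt, π.1.IsLAlgebraic →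
      ∀ (v : HeightOneSpectrum (𝓞 K)) (πv : SmoothIrrep (GL (Fin n) (v.adicCompletion K))),
        π.1.HasLocalComponentAt v πv.ρ →
        (𝓡.llc v).recGL n (IrrClass.mk πv) = (𝓡'.llc v).recGL n (IrrClass.mk πv)) :
    AutomorphicToGaloisR3plus n 𝓡 hcpt ↔ AutomorphicToGaloisR3plus n 𝓡' hcpt := by
  refine forall_congr' fun π ↦ forall_congr' fun hπ ↦ forall_congr' fun ℓ ↦
    forall_congr' fun _ ↦ forall_congr' fun ι ↦ exists_congr fun ρ ↦ ?_
  have hG : IsGeometricFramed 𝓡 ρ ↔ IsGeometricFramed 𝓡' ρ := Iff.rfl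
  rw [hG, correspondsR3plus_iff (h π hπ)]
  refine and_congr Iff.rfl (and_congr Iff.rfl (and_congr Iff.rfl (forall_congr' fun ρ' ↦ ?_)))
  rw [correspondsR3plus_iff (h π hπ)]

/-- Direction (B), R3⁺ form, is `𝓡`-independent given agreement on the local components of
L-algebraic cuspidal `π`. [folklore] -/
theorem galoisToAutomorphicR3plus_iff {𝓡 𝓡' : ReciprocityData K}
    (hcpt : isCompact_glFiniteIntegralLevel n K)
    (h : ∀ π : CuspidalAutomorphicRepData n K hcpt, π.1.IsLAlgebraic →
      ∀ (v : HeightOneSpectrum (𝓞 K)) (πv : SmoothIrrep (GL (Fin n) (v.adicCompletion K))),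
        π.1.HasLocalComponentAt v πv.ρ →
        (𝓡.llc v).recGL n (IrrClass.mk πv) = (𝓡'.llc v).recGL n (IrrClass.mk πv)) :
    GaloisToAutomorphicR3plus n 𝓡 hcpt ↔ GaloisToAutomorphicR3plus n 𝓡' hcpt := by
  refine forall_congr' fun ℓ ↦ forall_congr' fun _ ↦ forall_congr' fun ι ↦
    forall_congr' fun ρ ↦ forall_congr' fun _ ↦ ?_
  have hG : IsGeometricFramed 𝓡 ρ ↔ IsGeometricFramed 𝓡' ρ := Iff.rfl
  rw [hG]
  refine forall_congr' fun _ ↦ exists_congr fun π ↦ ?_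
  constructor
  · rintro ⟨hπ, hc⟩
    exact ⟨hπ, (correspondsR3plus_iff (h π hπ)).1 hc⟩
  · rintro ⟨hπ, hc⟩
    exact ⟨hπ, (correspondsR3plus_iff (h π hπ)).2 hc⟩

/-- **The R3⁺ correspondence for `GL_n/K` is `𝓡`-independent** given agreement of the two data on
the local components of L-algebraic cuspidal `π` of `GL_n(𝔸_K)`. [folklore] -/
theorem globalLanglandsCorrespondenceGLnR3plus_iff {𝓡 𝓡' : ReciprocityData K}
    (hcpt : isCompact_glFiniteIntegralLevel n K)
    (h : ∀ π : CuspidalAutomorphicRepData n K hcpt, π.1.IsLAlgebraic →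
      ∀ (v : HeightOneSpectrum (𝓞 K)) (πv : SmoothIrrep (GL (Fin n) (v.adicCompletion K))),
        π.1.HasLocalComponentAt v πv.ρ →
        (𝓡.llc v).recGL n (IrrClass.mk πv) = (𝓡'.llc v).recGL n (IrrClass.mk πv)) :
    GlobalLanglandsCorrespondenceGLnR3plus n K 𝓡 hcpt ↔
      GlobalLanglandsCorrespondenceGLnR3plus n K 𝓡' hcpt :=
  and_congr (automorphicToGaloisR3plus_iff hcpt h) (galoisToAutomorphicR3plus_iff hcpt h)

end R3plus

/-- **`LanglandsR3plus`, `∃ 𝓡` form.** Under (U_occ) at every number field — any two reciprocity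
data agree on every class `[π_v]` that is a local component of an L-algebraic cuspidal `π` of some
`GL_n(𝔸_K)` (the definiens of `RecAgreeOnCuspidalComponents K`, spelled out) — `LanglandsR3plus` is
equivalent to: for every number field there is SOME reciprocity datum for which the R3⁺ global
correspondence holds for all `n ≥ 1`.  The exact analogue of `langlands_iff_exists` for the summit.
[folklore] -/
theorem langlandsR3plus_iff_exists
    (hU : ∀ (K : Type) [Field K] [NumberField K] (𝓡 𝓡' : Summit.Langlands.ReciprocityData K)
      (n : ℕ) (hcpt : isCompact_glFiniteIntegralLevel n K) (π : CuspidalAutomorphicRepData n K hcpt),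
      π.1.IsLAlgebraic →
      ∀ (v : HeightOneSpectrum (𝓞 K)) (πv : SmoothIrrep (GL (Fin n) (v.adicCompletion K))),
        π.1.HasLocalComponentAt v πv.ρ →
        (𝓡.llc v).recGL n (IrrClass.mk πv) = (𝓡'.llc v).recGL n (IrrClass.mk πv)) :
    LanglandsR3plus ↔
      ∀ (F : Type) [Field F] [NumberField F], ∃ 𝓡 : Summit.Langlands.ReciprocityData F,
        ∀ n : ℕ, 0 < n → ∀ hcpt : isCompact_glFiniteIntegralLevel n F,
          R3plus.GlobalLanglandsCorrespondenceGLnR3plus n F 𝓡 hcpt := by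
  constructor
  · intro hL F _ _
    obtain ⟨⟨𝓡⟩, h⟩ := hL F
    exact ⟨𝓡, h 𝓡⟩
  · intro h F _ _
    obtain ⟨𝓡, h𝓡⟩ := h F
    refine ⟨⟨𝓡⟩, fun 𝓡' n hn hcpt ↦ ?_⟩
    exact (R3plus.globalLanglandsCorrespondenceGLnR3plus_iff hcpt
      (fun π hπ v πv hloc ↦ hU F 𝓡 𝓡' n hcpt π hπ v πv hloc)).1 (h𝓡 n hn hcpt)

/-- The unconditional half of `langlandsR3plus_iff_exists`: the `∀ 𝓡` form implies the `∃ 𝓡` form.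
[folklore] -/
theorem exists_of_langlandsR3plus (hL : LanglandsR3plus) (F : Type) [Field F] [NumberField F] :
    ∃ 𝓡 : Summit.Langlands.ReciprocityData F, ∀ n : ℕ, 0 < n →
      ∀ hcpt : isCompact_glFiniteIntegralLevel n F,
        R3plus.GlobalLanglandsCorrespondenceGLnR3plus n F 𝓡 hcpt := by
  obtain ⟨⟨𝓡⟩, h⟩ := hL F
  exact ⟨𝓡, h 𝓡⟩

end Summit.Langlands.Langlands.Theorems

end
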